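import Literature.MathematicalPhysics.QuantumLattice.EmeryThreeBandStatesNonempty
import Literature.MathematicalPhysics.QuantumLattice.FermionGroundStatesMinimiseMeanEnergy
import Literature.MathematicalPhysics.QuantumLattice.InfVolFermionStateProduct
import HarnessLib

/-!
# Extension of a cluster density matrix by the VACUUM of the remaining sites: `ρ_S ⊗ |∅⟩⟨∅|_{Λ∖S}` as an element of `𝔄_Λ` —
# even, positive, same trace, same expectations on `𝔄_S`, vacuum expectations on `𝔄_{Λ∖S}`; local Hamiltonians supported in `S`

Topic `Literature/MathematicalPhysics/QuantumLattice` (family `hubbard`, model-free, general `d`). Written for stage S2 of the Hubbard material-oracle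
programme (crew hubbard-fast, seat hubbard-box-p1): product trial states of DECORATED lattices (`PeriodicRectTrialState`, `EmeryThreeBandClusterTrialCap`)
are products of ONE density matrix `ρ₀` on a block of `ℤ^d` that contains sites no term of the model touches (the dummy sublattice of the decorated
`CuO₂` lattice); the cluster device that supplies `ρ₀` and its traces (hubbard-box-p2's coded clusters) should only ever see the PHYSICAL sites `S`.
This file is the glue: given `ρ_S ∈ 𝔄_S`, `S ⊆ Λ`,

* §1 the vacuum projector of the complement `vacProjCompl hS = Γ_{Λ∖S→Λ}(|∅⟩⟨∅|)` (even, positive) and **`vacExtend hS ρ_S = Γ_{S→Λ}(ρ_S) · vacProjCompl hS`**;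
* §2 the tracial-state factorisation (`InfVolFermionStateProduct.normTrace_mul_of_mem_carSubalgebra`) gives the TRACE IDENTITIES
  `tr(Γ_S(A) · vacProjCompl) = tr A` (`trace_fermionEmbed_mul_vacProjCompl`), **`tr(Γ_S(A) · vacExtend ρ_S) = tr(A ρ_S)`**,
  **`tr(Γ_{Λ∖S}(B) · vacExtend ρ_S) = tr(ρ_S) · B_{∅∅}`** (vacuum expectation on the complement), `tr(vacExtend ρ_S) = tr ρ_S`;
* §3 `vacExtend` is EVEN for even `ρ_S` and POSITIVE for positive `ρ_S` (commuting positive factors: `Γ_S(ρ_S) ∈ 𝔄_S`, the projector is an even element of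
  `𝔄_{Λ∖S}`; `Literature.LinearAlgebra.Matrix.posSemidef_mul_of_posSemidef_of_commute`);
* §4 NUMBER OPERATORS: one-site numbers of complement sites have zero expectation (`trace_nAt_compl_mul_vacExtend`), and
  `tr(N_Λ · vacExtend ρ_S) = tr(N_S ρ_S)` (`trace_totalNumber_mul_vacExtend`);
* §5 SUPPORT: an interaction all of whose non-zero terms inside `Λ` lie inside `S` has `H_Λ = Γ_{S→Λ}(H_S)` (`localHamiltonian_eq_fermionEmbed_of_support`),
  hence `tr(H_Λ · vacExtend ρ_S) = tr(H_S ρ_S)`.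

Everything is PROVED (0 sorry); definitions with bodies: `vacProjCompl`, `vacExtend`. HONEST SCOPE: finite-dimensional bookkeeping only.

## Tree / Mathlib search

REUSED: `normTrace`, `normTrace_mul_of_mem_carSubalgebra`, `normTrace_fermionEmbed` (`InfVolFermionStateProduct`); `fermionEmbed_mem_carSubalgebra`,
`fermionEmbed_mem_carEvenSubalgebra` (`FermionEmbedLocality`); `commute_of_mem_carEvenSubalgebra`, `disjoint_orbs`, `mem_orbs` (`FermionTraceFactorization`,
`HubbardBondAlgebra`); `JordanWigner.mem_carEvenSubalgebra_univ_of_parityAut_eq`; `posSemidef_fermionEmbed`; `parityAut_diagonal` (`EmeryThreeBandStatesNonempty`);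
`localHamiltonian_eq_fermionEmbed_add_far_add_cross` (`FermionGroundStatesMinimiseMeanEnergy`); `totalNumber_eq_sum_attach_nAt` (`ClusterProductStateEnergy`);
`fermionEmbed_fermionEmbed`, `fermionEmbed_numberOp`, `PolySite.incl(_pt/_trans)`, `card_polySite`, `numberAt_eq_diagonal`; Mathlib `Matrix.posSemidef_diagonal_iff`,
`Finset.card_sdiff_add_card_eq_card`, `Fintype.card_lex`. `rg 'vacExtend|vacProj|tensorVacuum'` (QuantumLattice, 2026-08-28): nothing.

## References

* H. Araki, H. Moriya, Rev. Math. Phys. 15 (2003) 93, §4.1 (tracial state, product property (4.16)), §11.1 Thm. 11.2. [cite: ArakiMoriya2003, §4.1 eq. (4.16)]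
* O. Bratteli, D. W. Robinson, *OAQSM 2* (1997), §5.2.2 (even elements of disjoint regions commute; Fock vacuum). [cite: BratteliRobinsonII1997, §5.2.2.2]
-/

noncomputable section

open scoped ComplexOrder BigOperators
open Finset

namespace Literature.MathematicalPhysics.QuantumLattice

open Matrix HubbardWave0 Literature.Probability.LatticeModels ThermodynamicLimit

variable {d : ℕ}

/-! ### §0. Orbital bookkeeping -/

/-- The vacuum indicator `χ_∅` on configurations: the diagonal of `|∅⟩⟨∅|`. [cite: BratteliRobinsonII1997, §5.2.2.2] -/
private def vacDiag (Λ : Finset (Site d)) : FermionOp Λ := diagonal fun s => if s = ∅ then 1 else 0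

/-- `|∅⟩⟨∅|` is even. [cite: ArakiMoriya2003, §4.1 Def. 4.2] -/
private theorem parityAut_vacDiag (Λ : Finset (Site d)) : parityAut (vacDiag Λ) = vacDiag Λ := parityAut_diagonal _

/-- `|∅⟩⟨∅|` is positive. [cite: BratteliRobinsonII1997, §5.2.2.2] -/
private theorem posSemidef_vacDiag (Λ : Finset (Site d)) : (vacDiag Λ).PosSemidef :=
  posSemidef_diagonal_iff.2 fun s => by by_cases h : s = ∅ <;> simp [h]

/-- `tr |∅⟩⟨∅| = 1`. [cite: BratteliRobinsonII1997, §5.2.2.2] -/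
private theorem trace_vacDiag (Λ : Finset (Site d)) : (vacDiag Λ).trace = 1 := by
  rw [vacDiag, trace_diagonal, Finset.sum_ite_eq' Finset.univ (∅ : Finset (Orb (PolySite Λ))) (fun _ => (1 : ℂ))]
  simp

/-- `tr(χ_∅ · B) = B_{∅∅}`. [cite: BratteliRobinsonII1997, §5.2.2.2] -/
private theorem trace_vacDiag_mul {Λ : Finset (Site d)} (B : FermionOp Λ) : (vacDiag Λ * B).trace = B ∅ ∅ := by
  rw [vacDiag, Matrix.trace]
  simp only [Matrix.diag_apply, Matrix.diagonal_mul, ite_mul, one_mul, zero_mul]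
  rw [Finset.sum_ite_eq' Finset.univ (∅ : Finset (Orb (PolySite Λ)))]
  simp

/-- The images of `S` and of `Λ ∖ S` in `PolySite Λ` have disjoint orbital sets. [cite: ArakiMoriya2003, §4.1 eq. (4.16)] -/
private theorem disjoint_orbs_incl {Λ S : Finset (Site d)} (hS : S ⊆ Λ) :
    Disjoint (orbs ((Finset.univ : Finset (PolySite S)).map (PolySite.incl hS)))
      (orbs ((Finset.univ : Finset (PolySite (Λ \ S))).map (PolySite.incl (Finset.sdiff_subset : Λ \ S ⊆ Λ)))) := by
  refine disjoint_orbs (Finset.disjoint_left.2 fun y hy hy' => ?_)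
  obtain ⟨a, -, ha⟩ := Finset.mem_map.1 hy
  obtain ⟨b, -, hb⟩ := Finset.mem_map.1 hy'
  have haS : ofLex y.1 ∈ S := by rw [← ha]; exact PolySite.ofLex_mem a
  have hbD : ofLex y.1 ∈ Λ \ S := by rw [← hb]; exact PolySite.ofLex_mem b
  exact (Finset.mem_sdiff.1 hbD).2 haS

/-! ### §1. The vacuum projector of the complement and the vacuum extension -/

section VacExtend

variable {Λ S : Finset (Site d)}

/-- **The vacuum projector of the complement** `Λ ∖ S`, as an element of `𝔄_Λ`: `Γ_{Λ∖S→Λ}(|∅⟩⟨∅|)` (the argument `hS : S ⊆ Λ` only fixes `S`).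
[cite: BratteliRobinsonII1997, §5.2.2.2] -/
def vacProjCompl (_hS : S ⊆ Λ) : FermionOp Λ :=
  fermionEmbed (PolySite.incl (Finset.sdiff_subset : Λ \ S ⊆ Λ)) (vacDiag (Λ \ S))

/-- **The vacuum extension** of a density matrix of `𝔄_S` to `𝔄_Λ`: `ρ_S ⊗ |∅⟩⟨∅|_{Λ∖S} := Γ_{S→Λ}(ρ_S) · Γ_{Λ∖S→Λ}(|∅⟩⟨∅|)`.
[cite: ArakiMoriya2003, §11.1 Theorem 11.2] -/
def vacExtend (hS : S ⊆ Λ) (ρ : FermionOp S) : FermionOp Λ :=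
  fermionEmbed (PolySite.incl hS) ρ * vacProjCompl hS

variable (hS : S ⊆ Λ)
include hS

/-- The vacuum projector is even. [cite: ArakiMoriya2003, §4.1 Def. 4.2] -/
theorem parityAut_vacProjCompl : parityAut (vacProjCompl hS) = vacProjCompl hS := by
  rw [vacProjCompl, ← fermionEmbed_parityAut, parityAut_vacDiag]

/-- The vacuum projector is positive. [cite: BratteliRobinsonII1997, §5.2.2.2] -/
theorem posSemidef_vacProjCompl : (vacProjCompl hS).PosSemidef :=
  posSemidef_fermionEmbed _ (posSemidef_vacDiag _)

/-- `Γ_S(A)` lies in the CAR subalgebra of the orbitals over `S`. [cite: ArakiMoriya2003, §4.1 Def. 4.1 (2)] -/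
theorem fermionEmbed_incl_mem_carSubalgebra (A : FermionOp S) :
    fermionEmbed (PolySite.incl hS) A ∈ carSubalgebra (orbs ((Finset.univ : Finset (PolySite S)).map (PolySite.incl hS))) :=
  fermionEmbed_mem_carSubalgebra _ A

/-- The vacuum projector lies in the EVEN CAR subalgebra of the orbitals over `Λ ∖ S`. [cite: ArakiMoriya2003, §4.1 Def. 4.2] -/
theorem vacProjCompl_mem_carEvenSubalgebra :
    vacProjCompl hS ∈ carEvenSubalgebra (orbs ((Finset.univ : Finset (PolySite (Λ \ S))).map (PolySite.incl (Finset.sdiff_subset : Λ \ S ⊆ Λ)))) :=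
  fermionEmbed_mem_carEvenSubalgebra _ (JordanWigner.mem_carEvenSubalgebra_univ_of_parityAut_eq (parityAut_vacDiag _))

/-- `Γ_S(A)` commutes with the vacuum projector of the complement (an even element of a disjoint region). [cite: BratteliRobinsonII1997, §5.2.2.2] -/
theorem commute_fermionEmbed_vacProjCompl (A : FermionOp S) : Commute (fermionEmbed (PolySite.incl hS) A) (vacProjCompl hS) :=
  (commute_of_mem_carEvenSubalgebra (vacProjCompl_mem_carEvenSubalgebra hS) (fermionEmbed_incl_mem_carSubalgebra hS A)
    (disjoint_orbs_incl hS).symm).symm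

/-! ### §2. Trace identities -/

/-- **`tr(Γ_S(A) · Γ_{Λ∖S}(B)) = tr(A) · tr(B)`-type factorisation through the tracial state**: `tr_Λ(Γ_S(A)·Γ_{Λ∖S}(B)) = tr_S(A) · tr_{Λ∖S}(B)`.
[cite: ArakiMoriya2003, §4.1 eq. (4.16)] -/
theorem trace_fermionEmbed_mul_fermionEmbed_compl (A : FermionOp S) (B : FermionOp (Λ \ S)) :
    (fermionEmbed (PolySite.incl hS) A * fermionEmbed (PolySite.incl (Finset.sdiff_subset : Λ \ S ⊆ Λ)) B).trace = A.trace * B.trace := by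
  have h := normTrace_mul_of_mem_carSubalgebra (fermionEmbed_incl_mem_carSubalgebra hS A)
    (fermionEmbed_mem_carSubalgebra (PolySite.incl (Finset.sdiff_subset : Λ \ S ⊆ Λ)) B) (disjoint_orbs_incl hS)
  rw [normTrace_fermionEmbed, normTrace_fermionEmbed, normTrace_apply, normTrace_apply, normTrace_apply, card_orb_polySite, card_orb_polySite,
    card_orb_polySite, ← Finset.card_sdiff_add_card_eq_card hS] at h
  have h2 : (2 : ℂ) ^ ((#(Λ \ S) + #S) * 2) = 2 ^ (#S * 2) * 2 ^ (#(Λ \ S) * 2) := by rw [← pow_add]; ring_nf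
  rw [h2, div_mul_div_comm] at h
  have hne : (2 : ℂ) ^ (#S * 2) * 2 ^ (#(Λ \ S) * 2) ≠ 0 := mul_ne_zero (pow_ne_zero _ two_ne_zero) (pow_ne_zero _ two_ne_zero)
  exact (div_left_inj' hne).1 h

/-- `tr_Λ(Γ_S(A) · vacProjCompl) = tr_S(A)`. [cite: ArakiMoriya2003, §4.1 eq. (4.16)] -/
theorem trace_fermionEmbed_mul_vacProjCompl (A : FermionOp S) : (fermionEmbed (PolySite.incl hS) A * vacProjCompl hS).trace = A.trace := by
  rw [vacProjCompl, trace_fermionEmbed_mul_fermionEmbed_compl, trace_vacDiag, mul_one]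

/-- **Expectations on `𝔄_S` are those of `ρ_S`**: `tr_Λ(Γ_S(A) · vacExtend ρ_S) = tr_S(A ρ_S)`. [cite: ArakiMoriya2003, §11.1 Theorem 11.2] -/
theorem trace_fermionEmbed_mul_vacExtend (A ρ : FermionOp S) :
    (fermionEmbed (PolySite.incl hS) A * vacExtend hS ρ).trace = (A * ρ).trace := by
  rw [vacExtend, ← Matrix.mul_assoc, ← fermionEmbed_mul, trace_fermionEmbed_mul_vacProjCompl]

/-- **Expectations on `𝔄_{Λ∖S}` are vacuum expectations**: `tr_Λ(Γ_{Λ∖S}(B) · vacExtend ρ_S) = tr(ρ_S) · B_{∅∅}`.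
[cite: ArakiMoriya2003, §11.1 Theorem 11.2] -/
theorem trace_fermionEmbed_compl_mul_vacExtend (B : FermionOp (Λ \ S)) (ρ : FermionOp S) :
    (fermionEmbed (PolySite.incl (Finset.sdiff_subset : Λ \ S ⊆ Λ)) B * vacExtend hS ρ).trace = ρ.trace * B ∅ ∅ := by
  rw [vacExtend, vacProjCompl, Matrix.trace_mul_comm, Matrix.mul_assoc, ← fermionEmbed_mul, trace_fermionEmbed_mul_fermionEmbed_compl,
    trace_vacDiag_mul]

/-- `tr(vacExtend ρ_S) = tr ρ_S`. [cite: ArakiMoriya2003, §11.1 Theorem 11.2] -/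
theorem trace_vacExtend (ρ : FermionOp S) : (vacExtend hS ρ).trace = ρ.trace := by
  rw [vacExtend, trace_fermionEmbed_mul_vacProjCompl]

/-! ### §3. Evenness and positivity -/

/-- The vacuum extension of an even density matrix is even. [cite: ArakiMoriya2003, §4.1 Def. 4.2] -/
theorem parityAut_vacExtend {ρ : FermionOp S} (hev : parityAut ρ = ρ) : parityAut (vacExtend hS ρ) = vacExtend hS ρ := by
  rw [vacExtend, map_mul, ← fermionEmbed_parityAut, hev, parityAut_vacProjCompl]

/-- The vacuum extension of a positive matrix is positive (commuting positive factors). [cite: BratteliRobinsonII1997, §5.2.2.2] -/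
theorem posSemidef_vacExtend {ρ : FermionOp S} (hρ : ρ.PosSemidef) : (vacExtend hS ρ).PosSemidef :=
  Literature.LinearAlgebra.Matrix.posSemidef_mul_of_posSemidef_of_commute (posSemidef_fermionEmbed _ hρ) (posSemidef_vacProjCompl hS)
    (commute_fermionEmbed_vacProjCompl hS ρ)

/-! ### §4. Number operators -/

/-- A one-site number operator of a site of `S`, read in `𝔄_Λ`, is the embedded one (isotony on generators). [cite: ArakiMoriya2003, §4.1 Def. 4.1 (2)] -/
theorem nAt_eq_fermionEmbed_incl {x : Site d} (hx : x ∈ S) (σ : Fin 2) :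
    (nAt x (hS hx) σ : FermionOp Λ) = fermionEmbed (PolySite.incl hS) (nAt x hx σ) := by
  rw [nAt, nAt, fermionEmbed_numberOp, PolySite.incl_pt]

omit hS in
/-- The number operators annihilate the vacuum: `(n_{x↑} + n_{x↓})_{∅∅} = 0`. [cite: BratteliRobinsonII1997, §5.2.2.2] -/
theorem nAt_add_nAt_apply_empty {X : Finset (Site d)} {x : Site d} (hx : x ∈ X) :
    (nAt x hx 0 + nAt x hx 1 : FermionOp X) ∅ ∅ = 0 := by
  rw [Matrix.add_apply, nAt, nAt, ← numberAt_orb, ← numberAt_orb, numberAt_eq_diagonal, numberAt_eq_diagonal, diagonal_apply_eq, diagonal_apply_eq]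
  simp

/-- **Complement sites carry no particle**: `tr((n_{y↑}+n_{y↓}) · vacExtend ρ_S) = 0` for `y ∈ Λ ∖ S`. [cite: ArakiMoriya2003, §11.1 Theorem 11.2] -/
theorem trace_nAt_compl_mul_vacExtend {y : Site d} (hy : y ∈ Λ \ S) (ρ : FermionOp S) :
    ((nAt y (Finset.sdiff_subset hy) 0 + nAt y (Finset.sdiff_subset hy) 1) * vacExtend hS ρ).trace = 0 := by
  rw [nAt_eq_fermionEmbed_incl (Λ := Λ) (S := Λ \ S) Finset.sdiff_subset hy,
    nAt_eq_fermionEmbed_incl (Λ := Λ) (S := Λ \ S) Finset.sdiff_subset hy, ← map_add,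
    trace_fermionEmbed_compl_mul_vacExtend, nAt_add_nAt_apply_empty, mul_zero]

/-- **The particle number of the extension is that of `ρ_S`**: `tr(N_Λ · vacExtend ρ_S) = tr(N_S ρ_S)`. [cite: ArakiMoriya2003, §4.1 (number operators)] -/
theorem trace_totalNumber_mul_vacExtend (ρ : FermionOp S) :
    ((totalNumber : FermionOp Λ) * vacExtend hS ρ).trace = ((totalNumber : FermionOp S) * ρ).trace := by
  classical
  rw [InfVolFermionState.totalNumber_eq_sum_attach_nAt Λ, InfVolFermionState.totalNumber_eq_sum_attach_nAt S, Finset.sum_mul, Finset.sum_mul,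
    Matrix.trace_sum, Matrix.trace_sum]
  -- split the sites of `Λ` into `S` and `Λ \ S`
  have hsplit : ∑ x ∈ Λ.attach, ((nAt x.1 x.2 0 + nAt x.1 x.2 1) * vacExtend hS ρ).trace =
      ∑ x ∈ Λ, (if hx : x ∈ Λ then ((nAt x hx 0 + nAt x hx 1) * vacExtend hS ρ).trace else 0) := by
    rw [← Finset.sum_attach Λ]
    exact Finset.sum_congr rfl fun x _ => by rw [dif_pos x.2]
  have hsplitS : ∑ x ∈ S.attach, ((nAt x.1 x.2 0 + nAt x.1 x.2 1) * ρ).trace =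
      ∑ x ∈ S, (if hx : x ∈ Λ then ((nAt x hx 0 + nAt x hx 1) * vacExtend hS ρ).trace else 0) := by
    rw [← Finset.sum_attach S]
    refine Finset.sum_congr rfl fun x _ => ?_
    rw [dif_pos (hS x.2), nAt_eq_fermionEmbed_incl hS x.2, nAt_eq_fermionEmbed_incl hS x.2, ← map_add, trace_fermionEmbed_mul_vacExtend]
  rw [hsplit, hsplitS, ← Finset.sum_sdiff hS, add_eq_right]
  refine Finset.sum_eq_zero fun y hy => ?_
  rw [dif_pos (Finset.sdiff_subset hy)]
  exact trace_nAt_compl_mul_vacExtend hS hy ρ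

end VacExtend

/-! ### §5. Local Hamiltonians supported in `S` -/

namespace FermionInteraction

/-- **An interaction whose non-zero terms inside `Λ` all lie inside `S ⊆ Λ` has `H_Λ = Γ_{S→Λ}(H_S)`.**
[cite: BratteliKishimotoRobinson1978, §3 (H̃_Φ(Λ), W_Φ(Λ), p. 47)] -/
theorem localHamiltonian_eq_fermionEmbed_of_support (Ψ : FermionInteraction d) {Λ S : Finset (Site d)} (hS : S ⊆ Λ)
    (h0 : ∀ X : Finset (Site d), X ⊆ Λ → ¬ X ⊆ S → Ψ.Φ X = 0) :
    Ψ.localHamiltonian Λ = fermionEmbed (PolySite.incl hS) (Ψ.localHamiltonian S) := by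
  rw [Ψ.localHamiltonian_eq_fermionEmbed_add_far_add_cross hS]
  have hz : ∀ (P : Finset (Site d) → Prop) [DecidablePred P],
      ∑ X ∈ Λ.powerset with (¬ X ⊆ S ∧ P X), (if h : X ⊆ Λ then fermionEmbed (PolySite.incl h) (Ψ.Φ X) else 0) = 0 := by
    intro P _
    refine Finset.sum_eq_zero fun X hX => ?_
    rw [Finset.mem_filter, Finset.mem_powerset] at hX
    rw [dif_pos hX.1, h0 X hX.1 hX.2.1, map_zero]
  rw [hz, hz, add_zero, add_zero]

/-- **Hence its block energy in the vacuum extension is the cluster energy on `S`**: `tr(H_Λ · vacExtend ρ_S) = tr(H_S ρ_S)`.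
[cite: ArakiMoriya2003, §11.1 Theorem 11.2] -/
theorem trace_localHamiltonian_mul_vacExtend (Ψ : FermionInteraction d) {Λ S : Finset (Site d)} (hS : S ⊆ Λ)
    (h0 : ∀ X : Finset (Site d), X ⊆ Λ → ¬ X ⊆ S → Ψ.Φ X = 0) (ρ : FermionOp S) :
    (Ψ.localHamiltonian Λ * vacExtend hS ρ).trace = (Ψ.localHamiltonian S * ρ).trace := by
  rw [Ψ.localHamiltonian_eq_fermionEmbed_of_support hS h0, trace_fermionEmbed_mul_vacExtend]

end FermionInteraction

end Literature.MathematicalPhysics.QuantumLattice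

end
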